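import Literature.NumberTheory.EllipticCurves.ZpExtensionRestrictProofs
import Literature.NumberTheory.GaloisRepresentations.LocalKroneckerWeberInertiaProofs
import HarnessLib

set_option autoImplicit false

/-!
# The restriction of the CYCLOTOMIC `ℤ_p`-extension along `L/K` is the cyclotomic `ℤ_p`-extension of `L`
# (`L·K_∞^{cyc} = L_∞^{cyc}`), in particular for every `L/K` of degree prime to `p`

Topic `Literature/NumberTheory/EllipticCurves` (companion of `ZpExtensionRestrict.lean` /
`ZpExtensionRestrictProofs.lean`).  THEOREM-ONLY file (no definition, no named fact, no `sorry`), written by the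
literature seat `bsd-potss-conjA-anchor` g10 (cell `bsd-potss`; supports stmt-BirchSwinnertonDyer-19386 / 19413) as
the first step of the tower identification `(L^H)_n = (L_n)^H` that the μ-descent theorems of
`Literature/NumberTheory/IwasawaTheory/ClassicalMuVanishesDescent.lean` take as a displayed hypothesis: the
sub-towers there are the CYCLOTOMIC `ℤ_p`-extensions of the subfields, and this file shows that they are all
restrictions of one cyclotomic `κ` of the base.

* `isCyclotomic_restrict` — if `κ` is the cyclotomic `ℤ_p`-extension of `K` (`ker κ = χ_{p,K}⁻¹(μ(ℤ_p))`,
  `ZpExtension.IsCyclotomic`) and `κ ∘ res` is surjective, then `κ.restrict L h` is the cyclotomic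
  `ℤ_p`-extension of `L`: `ker(κ∘res) = res⁻¹(ker κ)` (`kerSubgroup_restrict`) and `χ_{p,K} ∘ res = χ_{p,L}`
  (tree `cyclotomicCharacter_absGaloisRestrict`).  Washington §13.1: the cyclotomic `ℤ_p`-extension of any `L`
  is `L·ℚ_∞`, so `L·K_∞^{cyc} = L·K·ℚ_∞ = L_∞^{cyc}`.
* `exists_isCyclotomic_restrict_of_not_dvd_finrank` — with the tree's
  `surjective_comp_absGaloisRestrict_of_not_dvd_finrank`: for `p ∤ [L : K]` the cyclotomic `κ` of `K` restricts
  to a cyclotomic `ℤ_p`-extension `κ_L` of `L` with `κ_L σ = κ (res σ)` — e.g. `K = ℚ`, `L = ℚ(E[p])` or any of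
  its subfields when `p ∤ #Gal(ℚ(E[p])/ℚ)` (the Cartan-normaliser rows of the `bsd-potss` census).

References: [Washington1997] L. Washington, *Introduction to Cyclotomic Fields*, 2nd ed., §13.1 (`ℤ_p`-extensions,
the cyclotomic one, `K_∞L/L`).
-/

noncomputable section

open Field Literature.NumberTheory.GaloisRepresentations

universe u v

namespace Literature.NumberTheory.EllipticCurves.ZpExtension

variable {K : Type u} [Field K] [NumberField K] {p : ℕ} [Fact p.Prime]

/-- **The restriction of the cyclotomic `ℤ_p`-extension is cyclotomic**: if `κ` is the cyclotomic
`ℤ_p`-extension of `K` (`ker κ = χ_{p,K}⁻¹(μ(ℤ_p))`) and `κ ∘ res : Γ_L → ℤ_p` is surjective, then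
`κ.restrict L h` is the cyclotomic `ℤ_p`-extension of `L`, because `ker(κ ∘ res) = res⁻¹(ker κ)`
(`kerSubgroup_restrict`) and `χ_{p,K} ∘ res = χ_{p,L}` (`cyclotomicCharacter_absGaloisRestrict`):
`L·K_∞^{cyc} = L_∞^{cyc}`. [cite: Washington1997, §13.1] -/
theorem isCyclotomic_restrict (κ : ZpExtension K p) (hκ : κ.IsCyclotomic) (L : Type v) [Field L]
    [NumberField L] [Algebra K L]
    (h : Function.Surjective (κ.toContinuousMonoidHom.comp (absGaloisRestrict K L))) :
    (κ.restrict L h).IsCyclotomic := by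
  haveI : NeZero (p : K) := ⟨Nat.cast_ne_zero.mpr (Fact.out : p.Prime).ne_zero⟩
  unfold IsCyclotomic at hκ ⊢
  rw [kerSubgroup_restrict, hκ, Subgroup.comap_comap]
  congr 1
  exact MonoidHom.ext fun σ => cyclotomicCharacter_absGaloisRestrict K L p σ

/-- **The cyclotomic `ℤ_p`-extension of `K` restricts to the cyclotomic `ℤ_p`-extension of every `L/K` of
degree prime to `p`**: for such `L` there is a cyclotomic `ℤ_p`-extension `κ_L` of `L` with `κ_L σ = κ (res σ)`
for all `σ ∈ Γ_L` (surjectivity: tree `surjective_comp_absGaloisRestrict_of_not_dvd_finrank`, `L ∩ K_∞ = K`).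
[cite: Washington1997, §13.1] -/
theorem exists_isCyclotomic_restrict_of_not_dvd_finrank (κ : ZpExtension K p) (hκ : κ.IsCyclotomic)
    (L : Type v) [Field L] [NumberField L] [Algebra K L] (hL : ¬ p ∣ Module.finrank K L) :
    ∃ κL : ZpExtension L p, κL.IsCyclotomic ∧ ∀ σ, κL σ = κ (absGaloisRestrict K L σ) :=
  ⟨κ.restrict L (surjective_comp_absGaloisRestrict_of_not_dvd_finrank κ L hL),
    isCyclotomic_restrict κ hκ L _, fun σ => restrict_apply κ L _ σ⟩

/-- The kernel subgroups match: for `p ∤ [L : K]` and `κ` cyclotomic on `K`, EVERY cyclotomic `ℤ_p`-extension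
`κ'` of `L` has `ker κ' = res⁻¹(ker κ)` — the tower `L_∞^{cyc}` is `L·K_∞^{cyc}` whichever normalisation
`κ'` of `Gal(L_∞^{cyc}/L) ≃ ℤ_p` is chosen (both kernels equal `χ_{p,L}⁻¹(μ(ℤ_p))`). [cite: Washington1997, §13.1] -/
theorem IsCyclotomic.kerSubgroup_eq_comap_of_not_dvd_finrank (κ : ZpExtension K p) (hκ : κ.IsCyclotomic)
    (L : Type v) [Field L] [NumberField L] [Algebra K L] (hL : ¬ p ∣ Module.finrank K L)
    (κ' : ZpExtension L p) (hκ' : κ'.IsCyclotomic) :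
    κ'.kerSubgroup = κ.kerSubgroup.comap (absGaloisRestrict K L).toMonoidHom := by
  have h1 := isCyclotomic_restrict κ hκ L (surjective_comp_absGaloisRestrict_of_not_dvd_finrank κ L hL)
  unfold IsCyclotomic at h1 hκ'
  rw [hκ', ← h1, kerSubgroup_restrict]

end Literature.NumberTheory.EllipticCurves.ZpExtension

end
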